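import Literature.MathematicalPhysics.KineticTheory.InfiniteChainCurrentMoments
import Literature.MathematicalPhysics.KineticTheory.ZeroWavenumberSpace
import HarnessLib

/-!
# Moments of the energy density under Buttà–Marchioro's superstability estimate

Topic `Literature/MathematicalPhysics/KineticTheory` (companion of `InfiniteChainCurrentMoments` and
`ZeroWavenumberSpace`). The second generator of Doyon's local observables of the infinite chain, the
energy density `h_x = ½p_x² + U(q_x) + ½[V(q_{x+1} - q_x) + V(q_x - q_{x-1})]`
(`OscillatorChain.energyDensityZ`), is dominated by the local energy of the box `Λ_{x,1}`:
`0 ≤ h_x ≤ 2 W_{x,1}` for `U, V ≥ 0` (`energyDensityZ_le_two_mul_bmLocalEnergy`); hence under BM's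
superstability estimate (2.3) `h_x ∈ L^p(μ)` for every `p < ∞` (`HasSuperstabilityEstimate.memLp_energyDensityZ`),
and so is `h_x ∘ φ` for any `μ`-preserving `φ` — the square-integrability field `memLp_of_mem` of a
`ZeroWavenumberData` whose local observables are generated by `j₀` and `h₀` (with
`HasSuperstabilityEstimate.memLp_bondCurrentZ` of `InfiniteChainCurrentMoments`). Instances for
`pinnedChain`. Everything is proved; tagged `[folklore]`. No definitions, no named facts.
-/

noncomputable section

open MeasureTheory Filter Set Function
open scoped ENNReal

namespace Literature.MathematicalPhysics.KineticTheory.HeatConduction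

namespace OscillatorChain

variable (P : OscillatorChain)

/-- The energy density `σ ↦ h_x(σ)` is measurable when `U`, `V` are. [folklore] -/
theorem measurable_energyDensityZ (hUm : Measurable P.U) (hVm : Measurable P.V) (x : ℤ) :
    Measurable fun σ : ChainConfig => P.energyDensityZ σ x := by
  have hq : ∀ i : ℤ, Measurable fun σ : ChainConfig => (σ i).1 := fun i =>
    measurable_fst.comp (measurable_pi_apply i)
  have hp : ∀ i : ℤ, Measurable fun σ : ChainConfig => (σ i).2 := fun i =>
    measurable_snd.comp (measurable_pi_apply i)
  unfold energyDensityZ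
  exact ((((hp x).pow_const 2).div_const 2).add (hUm.comp (hq x))).add
    (((hVm.comp ((hq (x + 1)).sub (hq x))).add (hVm.comp ((hq x).sub (hq (x - 1))))).div_const 2)

variable {P}

/-- `0 ≤ h_x` for `U, V ≥ 0`. [folklore] -/
theorem energyDensityZ_nonneg (hU0 : ∀ r, 0 ≤ P.U r) (hV0 : ∀ r, 0 ≤ P.V r) (σ : ChainConfig)
    (x : ℤ) : 0 ≤ P.energyDensityZ σ x := by
  unfold energyDensityZ
  have h1 := hU0 (σ x).1
  have h2 := hV0 ((σ (x + 1)).1 - (σ x).1)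
  have h3 := hV0 ((σ x).1 - (σ (x - 1)).1)
  positivity

/-- **The energy density is dominated by the local energy**: `h_x ≤ 2 W_{x,1}` (`U, V ≥ 0`;
the site term and each of the two half-bonds is at most `W_{x,1}`). [folklore] -/
theorem energyDensityZ_le_two_mul_bmLocalEnergy (hU0 : ∀ r, 0 ≤ P.U r) (hV0 : ∀ r, 0 ≤ P.V r)
    (σ : ChainConfig) (x : ℤ) : P.energyDensityZ σ x ≤ 2 * P.bmLocalEnergy x 1 σ := by
  have hmem : ∀ i : ℤ, x - 1 ≤ i → i ≤ x + 1 → i ∈ Finset.Icc (x - ((1 : ℕ) : ℤ)) (x + ((1 : ℕ) : ℤ)) :=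
    fun i h1 h2 => by simp only [Finset.mem_Icc, Nat.cast_one]; omega
  have hsite := site_le_bmLocalEnergy hU0 hV0 σ (hmem x (by omega) (by omega))
  have hb1 : P.V ((σ (x + 1)).1 - (σ x).1) ≤ P.bmLocalEnergy x 1 σ := by
    have h := bond_le_bmLocalEnergy hU0 hV0 σ (hmem (x + 1) (by omega) le_rfl)
      (hmem (x + 1 - 1) (by omega) (by omega))
    simpa only [add_sub_cancel_right] using h
  have hb2 : P.V ((σ x).1 - (σ (x - 1)).1) ≤ P.bmLocalEnergy x 1 σ :=
    bond_le_bmLocalEnergy hU0 hV0 σ (hmem x (by omega) (by omega)) (hmem (x - 1) le_rfl (by omega))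
  unfold energyDensityZ
  linarith

/-- **The energy density lies in `L^p(μ)` for every `p < ∞`** under the superstability estimate (2.3)
(`U, V ≥ 0` measurable). [folklore] -/
theorem HasSuperstabilityEstimate.memLp_energyDensityZ {μ : Measure ChainConfig}
    (hss : P.HasSuperstabilityEstimate μ) (hU0 : ∀ r, 0 ≤ P.U r) (hV0 : ∀ r, 0 ≤ P.V r)
    (hUm : Measurable P.U) (hVm : Measurable P.V) (x : ℤ) {p : ℝ≥0∞} (hp : p ≠ ∞) :
    MemLp (fun σ => P.energyDensityZ σ x) p μ := by
  have hW : MemLp (fun σ => 2 * P.bmLocalEnergy x 1 σ) p μ :=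
    (hss.memLp_bmLocalEnergy hU0 hV0 hUm hVm x 1 hp).const_mul 2
  refine hW.of_le (P.measurable_energyDensityZ hUm hVm x).aestronglyMeasurable
    (Eventually.of_forall fun σ => ?_)
  rw [Real.norm_of_nonneg (energyDensityZ_nonneg hU0 hV0 σ x), Real.norm_of_nonneg]
  · exact energyDensityZ_le_two_mul_bmLocalEnergy hU0 hV0 σ x
  · linarith [one_le_bmLocalEnergy hU0 hV0 x 1 σ]

/-- Along a `μ`-preserving map (e.g. `D.flow t` under `D.PreservesMeasure μ`), `h_x ∘ φ ∈ L^p(μ)`. [folklore] -/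
theorem HasSuperstabilityEstimate.memLp_energyDensityZ_comp {μ : Measure ChainConfig}
    (hss : P.HasSuperstabilityEstimate μ) (hU0 : ∀ r, 0 ≤ P.U r) (hV0 : ∀ r, 0 ≤ P.V r)
    (hUm : Measurable P.U) (hVm : Measurable P.V) {φ : ChainConfig → ChainConfig}
    (hφ : MeasurePreserving φ μ μ) (x : ℤ) {p : ℝ≥0∞} (hp : p ≠ ∞) :
    MemLp ((fun σ => P.energyDensityZ σ x) ∘ φ) p μ :=
  (hss.memLp_energyDensityZ hU0 hV0 hUm hVm x hp).comp_measurePreserving hφ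

/-- Along a `μ`-preserving map, `j_x ∘ φ ∈ L^p(μ)` (`V` an even non-negative polynomial of degree
`≥ 2`). [folklore] -/
theorem HasSuperstabilityEstimate.memLp_bondCurrentZ_comp {μ : Measure ChainConfig}
    (hss : P.HasSuperstabilityEstimate μ) {s₂ : ℕ} (h₂ : 1 ≤ s₂) (hU0 : ∀ r, 0 ≤ P.U r)
    (hUm : Measurable P.U) (hV : IsEvenPolyOfDegree P.V s₂) {φ : ChainConfig → ChainConfig}
    (hφ : MeasurePreserving φ μ μ) (x : ℤ) {p : ℝ≥0∞} (hp : p ≠ ∞) :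
    MemLp ((fun σ => P.bondCurrentZ σ x) ∘ φ) p μ :=
  (hss.memLp_bondCurrentZ h₂ hU0 hUm hV x hp).comp_measurePreserving hφ

/-! ### The pinned anharmonic chain -/

/-- The coupling of `pinnedChain` is non-negative for `β ≥ 0`. [folklore] -/
theorem pinnedChain_V_nonneg (ω₂ lam : ℝ) {β : ℝ} (γ : ℝ) (hβ : 0 ≤ β) (r : ℝ) :
    0 ≤ (pinnedChain ω₂ lam β γ).V r := by
  show 0 ≤ r ^ 2 / 2 + β * r ^ 4 / 4
  positivity

/-- The coupling of `pinnedChain` is measurable. [folklore] -/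
theorem measurable_pinnedChain_V (ω₂ lam β γ : ℝ) : Measurable (pinnedChain ω₂ lam β γ).V := by
  show Measurable fun r : ℝ => r ^ 2 / 2 + β * r ^ 4 / 4
  fun_prop

/-- **Moments of the energy density for the pinned anharmonic chain** (`ω₂, lam, β ≥ 0`):
`h_x ∈ L^p(μ)` for every `p < ∞` and every superstable state `μ`. [folklore] -/
theorem memLp_energyDensityZ_pinnedChain {ω₂ lam β : ℝ} (γ : ℝ) (hω : 0 ≤ ω₂) (hl : 0 ≤ lam)
    (hβ : 0 ≤ β) {μ : Measure ChainConfig}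
    (hss : (pinnedChain ω₂ lam β γ).HasSuperstabilityEstimate μ) (x : ℤ) {p : ℝ≥0∞} (hp : p ≠ ∞) :
    MemLp (fun σ => (pinnedChain ω₂ lam β γ).energyDensityZ σ x) p μ :=
  hss.memLp_energyDensityZ (pinnedChain_U_nonneg β γ hω hl) (pinnedChain_V_nonneg ω₂ lam γ hβ)
    (measurable_pinnedChain_U ω₂ lam β γ) (measurable_pinnedChain_V ω₂ lam β γ) x hp

end OscillatorChain

end Literature.MathematicalPhysics.KineticTheory.HeatConduction

end
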